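import Literature.AlgebraicGeometry.Resolution.NearPointsTau
import Literature.AlgebraicGeometry.Resolution.HironakaTauScheme
import HarnessLib

/-!
# No near points over a curve centre when `τ(x) = 2` (CoP1, Lemma 4.3 (2))

Topic: `Literature/AlgebraicGeometry/Resolution`. [CoP1] = Cossart–Piltant, J. Algebra 320
(2008) 1051–1082, Lemma 4.3, p. 8: "With notations as above, the following holds: … (2) If
`τ(x) = 2` and `Y` is a curve, then no `x′ ∈ q⁻¹(x)` is near `x`." Here `q : X′ → X` is the
blowing up of the regular threefold `X` along a centre `Y` permissible for `E = (J, μ)` at `x`,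
`Y = V(y_1, y_2)` with `(y_1, y_2, u_3)` a regular system of parameters at `x` when `Y` is a
curve, and `x′` is near `x` iff `ord_{x′} J′ = μ` for the weak transform `J′` (`IsNear`).
PROVED (for a permissible blowing up of a regular locally Noetherian scheme of any dimension
along a regular centre that is, at `x`, cut out by two members of a regular system of
parameters):

* `IsBlowup.stalkTau_le_one_of_isNear` — **a near point `x′` over `x` forces `τ(x) ≤ 1`**: in
  the chart presentation `𝒪_{X′,x′} = (B_j)_𝔴` (`IsBlowup.exists_reesChart_stalk`), nearness
  puts every weak transform `F(e)`, `F` a form of degree `μ` with `F(y) ∈ J_x`, into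
  `𝔴^μ (B_j)_𝔴`, and `NearPointsTau.lean` ((10), (11) and the one-variable computation on the
  fibre line) gives `cl_μ(J_x) ⊆ k(x)[Y_l − a Y_j]`;
* `IsBlowup.not_isNear_of_two_le_stalkTau` — **Lemma 4.3 (2) as printed: if `τ(x) = 2` (or
  more) then no `x′` over `x` is near.**

## Sources

* V. Cossart, O. Piltant, J. Algebra 320 (2008) 1051–1082, Lemma 4.3 (2), p. 8.
  [CossartPiltant2008]
* H. Hironaka, Ann. of Math. 79 (1964), Ch. III — background (near points and the directrix).
-/

noncomputable section

open CategoryTheory CategoryTheory.Limits AlgebraicGeometry TopologicalSpace IsLocalRing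

namespace Literature.AlgebraicGeometry.Resolution

universe u

open Scheme.IdealSheafData

variable {X X' : Scheme.{u}} {π : X' ⟶ X}

set_option maxHeartbeats 400000 in
/-- **[CoP1] Lemma 4.3 (2): a near point over a curve centre forces `τ(x) ≤ 1`.** Let `π` be
the blowing up of the regular locally Noetherian scheme `X` along a regular centre
`Y ⊆ {y | ord_y J = μ}`, `μ ≥ 1`, let `x′ ∈ X′` lie over `x = π x′`, and suppose the ideal of
`Y` at `x` is generated by two elements `c = (c_1, c_2)` forming part of a regular system of
parameters of `𝒪_{X,x}` (`Y` is a curve through the closed point `x` of the threefold, in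
[CoP1]). If `x′` is near (`ord_{x′} J′ = μ`), then `τ(x) ≤ 1`.
[cite: CossartPiltant2008, Lemma 4.3 (2)] -/
theorem IsBlowup.stalkTau_le_one_of_isNear [IsLocallyNoetherian X] [IsLocallyNoetherian X']
    (hX : Scheme.IsRegular X) {Y : Closeds X} (hreg : Scheme.IsRegular (vanishingIdeal Y).subscheme)
    (hπ : IsBlowup π (vanishingIdeal Y)) {J : X.IdealSheafData} {μ : ℕ} (hμ : 1 ≤ μ)
    (hY : ∀ y ∈ (Y : Set X), idealOrder J y = μ) {x' : X'}
    [IsRegularLocalRing (X.presheaf.stalk (π x'))] {c : Fin 2 → X.presheaf.stalk (π x')}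
    (hcr : IsRsopPart c) (hcY : Ideal.span (Set.range c) = stalkIdeal (vanishingIdeal Y) (π x'))
    (hnear : IsNear π (vanishingIdeal Y) J μ x') :
    stalkTau J (π x') μ ≤ 1 := by
  classical
  -- a regular system of parameters at `x` to compute `τ(x)`
  obtain ⟨c₀, hc₀⟩ := exists_regularSystemOfParameters (R := X.presheaf.stalk (π x'))
  rw [stalkTau_eq J (π x') μ rfl c₀ hc₀]
  -- the chart presentation `𝒪_{X',x'} = (B_j)_𝔴`, `𝔴 ⊇ 𝔪 B_j`
  obtain ⟨j, 𝔴, χ, hχ, hloc, h𝔴⟩ := hπ.exists_reesChart_stalk x' c hcY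
  letI := χ.toAlgebra
  haveI : IsLocalization.AtPrime (X'.presheaf.stalk x') 𝔴.asIdeal := hloc
  have h𝔴' : (maximalIdeal _).map (chartBase c j) ≤ 𝔴.asIdeal := by
    rw [← h𝔴]
    exact Ideal.map_comap_le
  -- `J_x ⊆ P^μ`
  have hJP : stalkIdeal J (π x') ≤ Ideal.span (Set.range c) ^ μ := by
    rw [hcY, ← stalkIdeal_pow]
    exact stalkIdeal_mono (le_vanishingIdeal_pow_of_forall_idealOrder_eq hX hreg hY) _
  refine hironakaTauAt_le_one_of_near_of_isRsopPart hcr j hμ hJP 𝔴.asIdeal h𝔴' ?_ rfl c₀ hc₀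
  -- nearness: every weak transform `F(e)` lies in `𝔴^μ (B_j)_𝔴`
  intro F hF hFJ
  have hff' := reesChartBase_eval_eq_pow_mul_eval₂ c j hF
  have hu : ∀ l, (π.stalkMap x').hom (c l) = (π.stalkMap x').hom (c j) * χ (chartGen c j l) :=
    fun l => by rw [← hχ, ← hχ, ← map_mul, ← reesChartBase_apply_eq_mul_chartGen c j l]
  have hCmap : (stalkIdeal (vanishingIdeal Y) (π x')).map (π.stalkMap x').hom =
      Ideal.span {χ (chartBase c j (c j))} := by
    rw [← hcY, Ideal.map_span_range_eq_span_singleton _ c j _ hu, ← hχ]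
  have hmem : χ (MvPolynomial.eval₂Hom (chartBase c j) (fun l => chartGen c j l) F) ∈
      stalkIdeal (controlledTransform π (vanishingIdeal Y) J μ) x' := by
    rw [controlledTransform, stalkIdeal_colon, stalkIdeal_pow, stalkIdeal_comap_eq_map_stalkMap,
      stalkIdeal_comap_eq_map_stalkMap, hCmap]
    exact map_mem_colon_of_eq_pow_mul (chartBase c j) χ (π.stalkMap x').hom hχ hff' hFJ
  have hle : stalkIdeal (controlledTransform π (vanishingIdeal Y) J μ) x' ≤
      maximalIdeal (X'.presheaf.stalk x') ^ μ :=
    (le_idealOrder_iff _ x' μ).mp (isNear_iff.mp hnear).ge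
  by_contra hnot
  exact algebraMap_not_mem_maximalIdeal_pow_of_isLocalization 𝔴.asIdeal hnot (hle hmem)

/-- **[CoP1] Lemma 4.3 (2), as printed: "If `τ(x) = 2` and `Y` is a curve, then no
`x′ ∈ q⁻¹(x)` is near `x`."** [cite: CossartPiltant2008, Lemma 4.3 (2)] -/
theorem IsBlowup.not_isNear_of_two_le_stalkTau [IsLocallyNoetherian X] [IsLocallyNoetherian X']
    (hX : Scheme.IsRegular X) {Y : Closeds X} (hreg : Scheme.IsRegular (vanishingIdeal Y).subscheme)
    (hπ : IsBlowup π (vanishingIdeal Y)) {J : X.IdealSheafData} {μ : ℕ} (hμ : 1 ≤ μ)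
    (hY : ∀ y ∈ (Y : Set X), idealOrder J y = μ) {x' : X'}
    [IsRegularLocalRing (X.presheaf.stalk (π x'))] {c : Fin 2 → X.presheaf.stalk (π x')}
    (hcr : IsRsopPart c) (hcY : Ideal.span (Set.range c) = stalkIdeal (vanishingIdeal Y) (π x'))
    (hτ : 2 ≤ stalkTau J (π x') μ) :
    ¬ IsNear π (vanishingIdeal Y) J μ x' := fun hnear =>
  absurd (hπ.stalkTau_le_one_of_isNear hX hreg hμ hY hcr hcY hnear) (by omega)

/-- Equivalently: over such a point `x` with `τ(x) ≥ 2`, **the order of the weak transform drops: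
`ord_{x′} J′ < μ`.** [cite: CossartPiltant2008, Lemma 4.3 (2)] -/
theorem IsBlowup.idealOrder_controlledTransform_lt_of_two_le_stalkTau [IsLocallyNoetherian X]
    [IsLocallyNoetherian X'] (hX : Scheme.IsRegular X) {Y : Closeds X}
    (hreg : Scheme.IsRegular (vanishingIdeal Y).subscheme) (hπ : IsBlowup π (vanishingIdeal Y))
    {J : X.IdealSheafData} {μ : ℕ} (hμ : 1 ≤ μ) (hY : ∀ y ∈ (Y : Set X), idealOrder J y = μ)
    {x' : X'} [IsRegularLocalRing (X.presheaf.stalk (π x'))]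
    {c : Fin 2 → X.presheaf.stalk (π x')} (hcr : IsRsopPart c)
    (hcY : Ideal.span (Set.range c) = stalkIdeal (vanishingIdeal Y) (π x'))
    (hτ : 2 ≤ stalkTau J (π x') μ) :
    idealOrder (controlledTransform π (vanishingIdeal Y) J μ) x' < μ := by
  have hx : π x' ∈ (Y : Set X) := by
    rw [← coe_support_vanishingIdeal, SetLike.mem_coe, mem_support_iff_stalkIdeal_le, ← hcY]
    exact hcr.span_range_le_maximalIdeal
  have hle := hπ.idealOrder_controlledTransform_le_of_mem hX hreg hY hx
  refine lt_of_le_of_ne hle fun heq => ?_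
  exact hπ.not_isNear_of_two_le_stalkTau hX hreg hμ hY hcr hcY hτ (isNear_iff.mpr heq)

end Literature.AlgebraicGeometry.Resolution

end
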